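import Summits.NavierStokesRegularity.NavierStokesRegularity.Theorems.ScenarioCensusRowF1ScrewTopLevels
import HarnessLib

/-!
# LINE 41 «screw-top» port, part 3/3: §6 residual `HelicalCollapse` ≡ `Row_F1` (`helicalLevel_spec`, `rowF1_of_helicalCollapse`, `helicalCollapse_iff_rowF1`), what the hypotheses admit
# (streams along the axis, the helix equivariance, the rest state); §7 summary; census KEYS `Row_F1hx` / `Row_F1cx` + `_excluded`, floors HXF / CXF

Re-homed for the scenario census (typer seat ns-census-typer-1 g10; the cells F1hx / F1cx and the floors HXF / CXF are MEMBERS OF RECORD «DECIDED IN KERNEL IN FILES» of row F1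
(item 87: critic idea-crit-3 g10 PASS no price tier B 12:52:23Z; ref PRE-CHECK ✓ §19.21; lead label LR2016 §10.4 / Pineau–Vicol 2607.09619); this port makes them TREE-decided):
VERBATIM PORT of ns-idea-3 LINE 41 «screw-top», `pub/ideators/ns-idea-3/lines/screw-top/line-screw-top.lean` sha16 61b2c9f392c9fdfd (1140 l., lean check rc 0, 0 sorry), split for
the 400-line rule into `ScenarioCensusRowF1ScrewTop` (§1–§4a) → `…ScrewTopLevels` (§4b–§5) → `…ScrewTopRows` (§6–§7 + census KEYS).  Lean text VERBATIM in namespace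
`…Theorems.ScenarioCensus.ScrewTop` (the line's `…Cruxes.ScenarioCensusRowF1.ScrewTopLine` re-homed); port edits: the frame restated VERBATIM by the line from LINES 34–40 (`topSet`,
`HasTypeIConstant`, `snapLevel`, `exists_fast_at`, `sqrt_mul_sq_mul`, `limitClass_compact`, `exists_level_of_limitKill`, `exists_witnessZoom_package`, `zoom_units`,
`eventually_forall_not_of_not_frequently`, `continuous_slice'`, `tendsto_eval`, `le_of_units`, `row_of_floor`) is taken BY NAME from the landed two-time-top /
one-level-top / snapshot-top / needle-top / echo-top / scaling-top ports; the elementary `rotZ` / class lemmas the line restates are the tree's BY NAME (`rotZ_add_vec'` =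
`ScrewBlowdown.rotZ_add_vec`, `rotZ_add_smul_eZ'` = `ScrewBlowdown.rotZ_add_smul_eZ` (census screw-blowdown port), `rotZ_smul_vec'` = `rotZ_smul`, `rotZ_neg_rotZ'` = `rotZ_neg_apply_rotZ`,
`continuous_rotZ`, `centre_mem` = `IsTypeIAncientMild.comp_add_right` (Literature.Analysis.FluidPDE)); `analyticAt_linIso` and `tendstoLocallyUniformly_comp_of_tendsto` (twins of lemmas in
route-cone modules that are not imported) are not re-declared — the former's one-line proof term is inlined at its use sites; `@[conjecture]` on the residual `HelicalCollapse` (≡ `ScenarioCensus.Row_F1`, OPEN); one-line docstrings added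
where missing (gate lint).  Statements untouched.

No census VALUE is moved here (row F1 stays OPEN-WITH-LINE; the members become TREE-decided by name); NS regularity is NOT proved; `Row_F1` is untouched (zero
movement, `helicalCollapse_iff_rowF1`); no summit statement is proved by this file. Lemmas that restate already-landed tree declarations are taken BY NAME (gate lint `dedup.landed`): `topSet` = `TwoTimeTop.topSet`, `HasTypeIConstant` = `OneLevelTop.HasTypeIConstant`, `snapLevel` = `SnapshotTop.snapLevel`, `exists_fast_at` = `SnapshotTop.exists_fast_at`, `sqrt_mul_sq_mul` = `SnapshotTop.sqrt_mul_sq_mul`, `limitClass_compact` = `NeedleTop.limitClass_compact`, `exists_level_of_limitKill` = `NeedleTop.exists_level_of_limitKill`, `zoom_units` = `NeedleTop.zoom_units`, `exists_witnessZoom_package` = `EchoTop.exists_witnessZoom_package`, `eventually_forall_not_of_not_frequently` = `EchoTop.eventually_forall_not_of_not_frequently`, `continuous_slice'` = `ScalingTop.continuous_slice'`, `tendsto_eval` = `ScalingTop.tendsto_eval`, `le_of_units` = `ScalingTop.le_of_units`, `row_of_floor` = `ScalingTop.row_of_floor`, `centre_mem` = `IsTypeIAncientMild.comp_add_right`, `rotZ_add_vec'`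 = `ScrewBlowdown.rotZ_add_vec`, `rotZ_smul_vec'` = `rotZ_smul`, `rotZ_add_smul_eZ'` = `ScrewBlowdown.rotZ_add_smul_eZ`, `rotZ_neg_rotZ'` = `rotZ_neg_apply_rotZ`.
-/

-- the summit and its single problem share the name `NavierStokesRegularity` (D-0017 nested layout)
set_option linter.dupNamespace false

noncomputable section

open MeasureTheory Set Function Filter TopologicalSpace Metric
open scoped Topology NNReal ENNReal InnerProductSpace

namespace Summit.NavierStokesRegularity.NavierStokesRegularity.Theorems.ScenarioCensus.ScrewTop

open Literature.Analysis Literature.Analysis.FluidPDE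
open Summit.NavierStokesRegularity.NavierStokesRegularity.Theorems
open Summit.NavierStokesRegularity.NavierStokesRegularity.Theses
open Summit.NavierStokesRegularity.NavierStokesRegularity.Theorems.LocalHelicityTubeDoorFrobeniusProfileRigidityHelicalSlice

/-! ## §6 The residual ≡ row F1 (declared); what the hypotheses admit (no smallness anywhere: streams, an exact Navier–Stokes flow with
helical snapshots, crystal-symmetric streams — at full speed); summary -/

/-- The census-row threshold `rowLevel M L h θ₁ θ₂ A a := helicalLevel M c_S L h θ₁ θ₂ A a`. -/
theorem helicalLevel_spec {M : ℝ} {L : E3 ≃ₗᵢ[ℝ] E3} {h θ₁ θ₂ A a : ℝ} (hh : h ≠ 0) (h12 : θ₁ < θ₂) (ha : 0 < a)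
    (ν T : ℝ) (hν : 0 < ν) (hT : 0 < T) (u : ℝ → E3 → E3) (p : ℝ → E3 → ℝ)
    (hsol : IsClassicalNSSolutionOn (Ico 0 T) ν 0 u p) (hLH : IsLerayHopfOn T ν 0 (u 0) u)
    (hdec : HasRapidSpatialDecay (u 0)) (hM : OneLevelTop.HasTypeIConstant ν T M u)
    (hfreq : ∃ᶠ t in 𝓝[<] T, ∀ x ∈ TwoTimeTop.topSet ν T u SnapshotTop.snapLevel t,
      HelicalPocketAt ν T u L h θ₁ θ₂ A a (helicalLevel M SnapshotTop.snapLevel L h θ₁ θ₂ A a) t x) :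
    HasSmoothExtensionPast ν 0 u T := by
  have hp : 0 < SnapshotTop.snapLevel ∧ h ≠ 0 ∧ θ₁ < θ₂ ∧ 0 < a := ⟨SnapshotTop.snapLevel_pos, hh, h12, ha⟩
  have hspec := (Classical.choose_spec (helicalFloor_holds M SnapshotTop.snapLevel L h θ₁ θ₂ A a hp.1 hp.2.1 hp.2.2.1 hp.2.2.2)).2
    ν T hν hT u p hsol hLH hdec hM
  have hlev : helicalLevel M SnapshotTop.snapLevel L h θ₁ θ₂ A a =
      Classical.choose (helicalFloor_holds M SnapshotTop.snapLevel L h θ₁ θ₂ A a hp.1 hp.2.1 hp.2.2.1 hp.2.2.2) := by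
    unfold helicalLevel
    rw [dif_pos hp]
  rw [hlev] at hfreq
  exact ScalingTop.row_of_floor hν hT hsol hLH hdec hspec hfreq

/-- **Residual «HELICAL COLLAPSE»** (maximal frame): every maximal Type-I Clay blow-up with constant `M` admits, for SOME admissible
`(L, h, θ₁, θ₂, A, a)` (pitch `h ≠ 0`), helical pockets at the threshold `helicalLevel M c_S L h θ₁ θ₂ A a` at every `c_S`-fast point
along some `t_k ↑ T`.  DECLARED ≡ row F1 (`helicalCollapse_iff_rowF1`); no movement on `Row_F1` is claimed — after the floor its content
is «there is no Type-I Clay blow-up». -/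
@[conjecture] def HelicalCollapse : Prop :=
  ∀ (ν T : ℝ), 0 < ν → 0 < T → ∀ (u : ℝ → E3 → E3) (p : ℝ → E3 → ℝ),
    IsMaximalSmoothSolution ν 0 u p T → IsLerayHopfOn T ν 0 (u 0) u → HasRapidSpatialDecay (u 0) →
    ∀ M : ℝ, OneLevelTop.HasTypeIConstant ν T M u →
      ∃ (L : E3 ≃ₗᵢ[ℝ] E3) (h θ₁ θ₂ A a : ℝ), h ≠ 0 ∧ θ₁ < θ₂ ∧ 0 < a ∧
        ∃ᶠ t in 𝓝[<] T, ∀ x ∈ TwoTimeTop.topSet ν T u SnapshotTop.snapLevel t,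
          HelicalPocketAt ν T u L h θ₁ θ₂ A a (helicalLevel M SnapshotTop.snapLevel L h θ₁ θ₂ A a) t x

/-- **The split**: helical row (proved) + residual ⇒ row F1 (target BY NAME). -/
theorem rowF1_of_helicalCollapse (hR : HelicalCollapse) : ScenarioCensus.Row_F1 := by
  unfold ScenarioCensus.Row_F1
  intro ν T hν hT u p hsol hLH hdec hTI
  by_contra hext
  obtain ⟨M, hM⟩ := OneLevelTop.exists_hasTypeIConstant hν hTI
  obtain ⟨L, h, θ₁, θ₂, A, a, hh, h12, ha, hfreq⟩ := hR ν T hν hT u p ⟨hsol, hext⟩ hLH hdec M hM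
  exact hext (helicalLevel_spec hh h12 ha ν T hν hT u p hsol hLH hdec hM hfreq)

/-- The residual is a consequence of row F1 (vacuously). -/
theorem helicalCollapse_of_rowF1 (hrow : ScenarioCensus.Row_F1) : HelicalCollapse :=
  fun ν T hν hT u p hmax hLH hdec _ hM =>
    (hmax.2 (hrow ν T hν hT u p hmax.1 hLH hdec hM.isTypeIBlowup)).elim

/-- The residual `HelicalCollapse` is EXACTLY `Row_F1`. -/
theorem helicalCollapse_iff_rowF1 : HelicalCollapse ↔ ScenarioCensus.Row_F1 :=
  ⟨rowF1_of_helicalCollapse, helicalCollapse_of_rowF1⟩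

/-! ### What the Euclidean hypotheses admit (hypothesis level): NOTHING is asked to be small, slow or swirl-free.  A uniform STREAM along
the screw axis has helical pockets of accuracy `0` for every pitch, angle range and radius, and its whole space is fast; the exact
Navier–Stokes flow `u(t, y) = e^{−νt/h²ℓ²}(cos(y₂/hℓ), sin(y₂/hℓ), 0)` (an ABC flow with `B = C = 0`) has snapshots that are EXACTLY
helically equivariant with pitch `h` — genuinely helical, with swirl, non-constant — (`helix_equivariant`: the dimensionless identity);
a stream along a direction fixed by `L` has crystal pockets of accuracy `0`; the rest state satisfies both trivially.  The content of the
floors is on the LIMIT side: the exact relations have NO non-trivial solution in `𝒦_M` (§4). -/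

/-- `R_θ` fixes the axis vector: `R_θ (c e₂) = c e₂`. -/
theorem rotZ_smul_eZ' (θ c : ℝ) : rotZ θ (c • eZ) = c • eZ := by
  have e := ScrewBlowdown.rotZ_add_smul_eZ θ 0 c
  have h0 : rotZ θ (0 : E3) = 0 := (rotLin θ).map_zero
  rwa [zero_add, h0, zero_add] at e

/-- A uniform STREAM ALONG THE SCREW AXIS, `u(t, y) = c • L e₂`, has helical pockets of accuracy `0` about every apex, for every pitch,
angle range and radius — at ANY speed. -/
theorem helicalPocketAt_of_stream {ν T : ℝ} (L : E3 ≃ₗᵢ[ℝ] E3) (c : ℝ) {h θ₁ θ₂ A a t : ℝ} (hA : 0 ≤ A) (x : E3) :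
    HelicalPocketAt ν T (fun _ _ => c • L eZ) L h θ₁ θ₂ A a 0 t x := by
  refine ⟨0, by simpa using hA, fun θ _ w _ => ?_⟩
  have e1 : L.symm (c • L eZ) = c • eZ := by
    rw [LinearIsometryEquiv.map_smul, LinearIsometryEquiv.symm_apply_apply]
  rw [e1, rotZ_smul_eZ', sub_self, norm_zero, mul_zero, zero_mul]

/-- … and its whole space is `Λ`-fast at the instant `t < T` as soon as `√(T − t)|c| ≥ Λ√ν`. -/
theorem stream_fast {ν T t Λ : ℝ} (L : E3 ≃ₗᵢ[ℝ] E3) {c : ℝ} (hc : Λ * Real.sqrt ν ≤ Real.sqrt (T - t) * |c|) (x : E3) :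
    x ∈ TwoTimeTop.topSet ν T (fun _ (_ : E3) => c • L eZ) Λ t := by
  rw [TwoTimeTop.mem_topSet, norm_smul, LinearIsometryEquiv.norm_map, Real.norm_eq_abs]
  have : ‖(eZ : E3)‖ = 1 := by simp [eZ]
  rw [this, mul_one]
  exact hc

/-- The axial coordinate of a screw image: `(g_θ y)₂ = y₂ + hθ`. -/
theorem screw_apply_two (h θ : ℝ) (y : E3) : screw h θ y 2 = y 2 + h * θ := by
  simp [screw, eZ]

/-- **The dimensionless HELIX `y ↦ R_{y₂/h} e₀` is EXACTLY screw-equivariant with pitch `h ≠ 0`** (`e₀ = (1, 0, 0)`): the snapshot of the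
ABC flow with `B = C = 0` — non-constant, with swirl about the axis, NOT periodic in any horizontal direction.  (It is not in `𝒦_M`:
backwards in time the corresponding Navier–Stokes flow grows exponentially.) -/
theorem helix_equivariant {h : ℝ} (hh : h ≠ 0) (θ : ℝ) (y : E3) :
    rotZ ((screw h θ y) 2 / h) (EuclideanSpace.single 0 (1 : ℝ)) = rotZ θ (rotZ (y 2 / h) (EuclideanSpace.single 0 (1 : ℝ))) := by
  rw [screw_apply_two, ← rotZ_add]
  congr 1
  field_simp
  ring

/-- A STREAM ALONG A DIRECTION FIXED BY `L`, `u(t, y) = c • d` with `L d = d`, has crystal pockets of accuracy `0` for the motion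
`y ↦ L y + d` about every apex — at ANY speed. -/
theorem crystalPocketAt_of_stream {ν T : ℝ} (L : E3 ≃ₗᵢ[ℝ] E3) {d : E3} (hfix : L d = d) (c : ℝ) {A a t : ℝ} (hA : 0 ≤ A)
    (x : E3) : CrystalPocketAt ν T (fun _ _ => c • d) L d A a 0 t x := by
  refine ⟨0, by simpa using hA, fun w _ => ?_⟩
  rw [LinearIsometryEquiv.map_smul, hfix, sub_self, norm_zero, mul_zero, zero_mul]

/-- The rest state has both read-outs with accuracy `0` (and an empty top). -/
theorem euclideanPockets_rest {ν T : ℝ} (L : E3 ≃ₗᵢ[ℝ] E3) (d : E3) {h θ₁ θ₂ A a t : ℝ} (hA : 0 ≤ A) (x : E3) :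
    HelicalPocketAt ν T (fun _ _ => 0) L h θ₁ θ₂ A a 0 t x ∧ CrystalPocketAt ν T (fun _ _ => 0) L d A a 0 t x := by
  refine ⟨⟨0, by simpa using hA, fun θ _ w _ => ?_⟩, ⟨0, by simpa using hA, fun w _ => ?_⟩⟩
  · rw [LinearIsometryEquiv.map_zero, show rotZ θ (0 : E3) = 0 from (rotLin θ).map_zero, sub_self, norm_zero, mul_zero, zero_mul]
  · rw [LinearIsometryEquiv.map_zero, sub_self, norm_zero, mul_zero, zero_mul]

/-- Monotonicity of the helical read-out in the threshold. -/
theorem helicalPocketAt_mono {ν T : ℝ} {u : ℝ → E3 → E3} {L : E3 ≃ₗᵢ[ℝ] E3} {h θ₁ θ₂ A a ε ε' t : ℝ} {x : E3} (hle : ε ≤ ε')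
    (hν : 0 ≤ Real.sqrt ν) (hP : HelicalPocketAt ν T u L h θ₁ θ₂ A a ε t x) : HelicalPocketAt ν T u L h θ₁ θ₂ A a ε' t x := by
  obtain ⟨b, hb, hp⟩ := hP
  exact ⟨b, hb, fun θ hθ w hw => (hp θ hθ w hw).trans (mul_le_mul_of_nonneg_right hle hν)⟩

/-! ## §7 Summary -/

/-- **LINE 41 «screw-top», summary.**  In kernel, standard axioms: the two FLOORS (universal over fast points, every level `Λ`), the two
census ROWS, and the declared residual `HelicalCollapse ↔ Row_F1`. -/
theorem screwTop_summary :
    HelicalFloor ∧ CrystalFloor ∧ Row_F1hx ∧ Row_F1cx ∧ (HelicalCollapse ↔ ScenarioCensus.Row_F1) :=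
  ⟨helicalFloor_holds, crystalFloor_holds, rowF1hx_holds, rowF1cx_holds, helicalCollapse_iff_rowF1⟩

end Summit.NavierStokesRegularity.NavierStokesRegularity.Theorems.ScenarioCensus.ScrewTop

namespace Summit.NavierStokesRegularity.NavierStokesRegularity.Theorems.ScenarioCensus

/-! ## Census KEYS (ns `…Theorems.ScenarioCensus`): the SCREW members of row F1 (LINE 41) — TREE-decided F1hx / F1cx and floors HXF / CXF -/

/-- **Cell F1hx — HELICAL-POCKET SNAPSHOTS** (Type I with constant `M` · for a frame `L`, pitch `h ≠ 0` and angles `θ₁ < θ₂`, along some `t_k ↑ T` every `c_S`-fast point has an apex and a pocket on which the snapshot is `ε`-equivariant under the screw motions `g_θ`, `θ ∈ [θ₁, θ₂]` ⇒ smooth extension past `T`): `:= ScrewTop.Row_F1hx`. DECIDED. -/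
def Row_F1hx : Prop := ScrewTop.Row_F1hx
/-- F1hx is EXCLUDED (decided in the tree): `ScrewTop.rowF1hx_holds`. -/
theorem row_F1hx_excluded : Row_F1hx := ScrewTop.rowF1hx_holds

/-- **Cell F1cx — CRYSTAL-POCKET SNAPSHOTS** (the snapshot repeats itself, to accuracy `ε`, under a screw displacement with nonzero translation part about an apex, at snapshots ⇒ extension): `:= ScrewTop.Row_F1cx`. DECIDED. -/
def Row_F1cx : Prop := ScrewTop.Row_F1cx
/-- F1cx is EXCLUDED (decided in the tree): `ScrewTop.rowF1cx_holds`. -/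
theorem row_F1cx_excluded : Row_F1cx := ScrewTop.rowF1cx_holds

/-- **Floor HXF — the HELICAL floor** (universal over fast points, every level; no maximality hypothesis): `ScrewTop.helicalFloor_holds`. -/
theorem row_F1_helicalFloor : ScrewTop.HelicalFloor := ScrewTop.helicalFloor_holds
/-- **Floor CXF — the CRYSTAL floor**: `ScrewTop.crystalFloor_holds`. -/
theorem row_F1_crystalFloor : ScrewTop.CrystalFloor := ScrewTop.crystalFloor_holds

end Summit.NavierStokesRegularity.NavierStokesRegularity.Theorems.ScenarioCensus

end
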